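import Summits.AnomalousDissipation.AnomalousDissipation.Theorems.MirrorVarietyTaylorGreenLoudGalerkinStatesLine
import Summits.AnomalousDissipation.AnomalousDissipation.Theorems.TaylorGreenLogLoudStates.Negative.Eigenforce
import Literature.Analysis.FunctionSpaces.TorusLinearisedFormTruncation
import Literature.Analysis.FunctionSpaces.TorusFourierModes

/-!
# Stub `stub_automaticLoudness` of the line `stagnation-plug-froth`
# (crux stmt-AnomalousDissipation-2987, `MirrorVariety.TaylorGreenLoudGalerkinStates`; skeleton v4, gauge reshape)

**Loudness is automatic in the amplitude gauge** (the registered signature, verbatim): for a `K`-field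
`v ⊥ f_TG` such that `U := 2•f_TG + v` satisfies the frozen-cell tested equations at viscosity `ν > 0` against
every `K`-field `b ⊥ f_TG`, and `∫|v|² ≤ C`, one has `ν‖∇v‖² ≤ 100(√C + C)`.

Proof.  (1) Test with `b := v`: `∫⟪U,(U·∇)v⟫ + ν∫⟪U,Δv⟫ + ∫⟪f,v⟫ = 0`; the last term vanishes,
`∫⟪f, Δv⟫ = ∫⟪Δf, v⟫ = −12π²∫⟪f, v⟫ = 0` (Green `Torus.integral_inner_laplacian_comm` and the eigenfield identity
`integral_inner_laplacian_tgForce`) and `∫⟪v,Δv⟫ = −‖∇v‖²` (`Torus.integral_inner_laplacian_eq_neg_holds`), so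
`ν‖∇v‖² = ∫⟪U,(U·∇)v⟫` (`gradNormSq_eq_integral_inner_convect`).  (2) `(U·∇)v = 2(f·∇)v + (v·∇)v` pointwise
(linearity of `Torus.fderiv v x`), and the antisymmetry of the trilinear form for the divergence-free smooth
transporting fields `f`, `v` (`Torus.integral_inner_convect_eq_neg`) gives
`ν‖∇v‖² = −4∫⟪(f·∇)f, v⟫ − 2∫⟪(v·∇)f, v⟫` (`integral_inner_convect_gauge`).  (3) Pointwise
`‖(b·∇)f_TG (x)‖ ≤ 25‖b x‖` (`norm_convect_tgForce_le`: Frobenius bound `Torus.norm_convect_le_norm_mul_sqrt`,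
the trig-poly bound `Torus.norm_partialDeriv_realTrigPoly_le` on the TG shell with `‖f̂(k)‖ ≤ 3/16`, `|kⱼ| = 1`,
so `‖∂ⱼf_TG‖ ≤ 3π ≤ 12` and `3·12² ≤ 25²`), `‖f_TG‖ ≤ 1`, and `∫‖v‖ ≤ √(∫‖v‖²)` give
`ν‖∇v‖² ≤ 100√C + 50C ≤ 100(√C + C)` (the sharp constant is `π√C + 4πC`).

References: R. Temam, *Navier–Stokes Equations* (1979/1984), Ch. II §1.2 (trilinear form, energy identity);
L. C. Evans, *PDE* (2010), App. C.2 (Green's identities).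
-/

-- `Summit.<Summit>.<Problem>` is the tree's mandated summit-side namespace (CONVENTIONS §2); for this
-- single-conjunct summit the two coincide, so the duplicate is deliberate.
set_option linter.dupNamespace false
noncomputable section
open scoped BigOperators Topology InnerProductSpace
open Filter MeasureTheory
open Literature.Analysis.FunctionSpaces Literature.Analysis.FunctionSpaces.Torus
namespace Summit.AnomalousDissipation.AnomalousDissipation.Theorems.TaylorGreenLoudGalerkinStates.AutomaticLoudness
open Summit.AnomalousDissipation.AnomalousDissipation.Theorems.TaylorGreenLoudGalerkinStates
open Summit.AnomalousDissipation.AnomalousDissipation.Theorems.TaylorGreenLoudGalerkinStates.Negative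

/-! ## §1 Pointwise bounds for the derivative of the Taylor–Green force -/

/-- On the TG shell `‖f̂(k)‖ ≤ 3/16` (`‖f̂(k)‖² = 1/32 ≤ 9/256`). [folklore] -/
theorem norm_tgCoeff_le {k : Fin 3 → ℤ} (hk : k ∈ tgShell) : ‖tgCoeff k‖ ≤ 3 / 16 := by
  have h := norm_sq_tgCoeff hk
  nlinarith [norm_nonneg (tgCoeff k)]

/-- Coordinates of TG shell vectors have modulus one. [folklore] -/
theorem abs_cast_apply_of_mem_tgShell {k : Fin 3 → ℤ} (hk : k ∈ tgShell) (j : Fin 3) :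
    |((k j : ℤ) : ℝ)| = 1 := by
  rw [tgShell, Fintype.mem_piFinset] at hk
  have hj := hk j
  simp only [Finset.mem_insert, Finset.mem_singleton] at hj
  rcases hj with h | h <;> simp [h]

/-- Pointwise bound `‖∂ⱼ f_TG (x)‖ ≤ 12` for each partial derivative of the Taylor–Green force
(trig-poly bound `Σ_{shell} 2π|kⱼ|‖f̂(k)‖ ≤ 8 · 2π · 3/16 = 3π ≤ 12`). [folklore] -/
theorem norm_partialDeriv_tgForce_le (j : Fin 3) (x : UnitAddTorus (Fin 3)) :
    ‖partialDeriv j tgForce x‖ ≤ 12 := by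
  rw [tgForce_eq_realTrigPoly]
  refine (norm_partialDeriv_realTrigPoly_le tgShell tgCoeff j x).trans ?_
  calc ∑ k ∈ tgShell, 2 * Real.pi * |((k j : ℤ) : ℝ)| * ‖tgCoeff k‖
      ≤ ∑ _k ∈ tgShell, 2 * Real.pi * 1 * (3 / 16) := by
        refine Finset.sum_le_sum fun k hk => ?_
        rw [abs_cast_apply_of_mem_tgShell hk j]
        exact mul_le_mul_of_nonneg_left (norm_tgCoeff_le hk) (by positivity)
    _ = 8 * (2 * Real.pi * 1 * (3 / 16)) := by
        rw [Finset.sum_const, card_tgShell, nsmul_eq_mul]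
        norm_num
    _ ≤ 12 := by nlinarith [Real.pi_le_four]

/-- **Pointwise bound for the convective derivative of the Taylor–Green force along any field**:
`‖(b·∇)f_TG (x)‖ ≤ 25‖b x‖` (Frobenius bound and `‖∂ⱼf_TG‖ ≤ 12`, `3·12² ≤ 25²`). [folklore] -/
theorem norm_convect_tgForce_le (b : UnitAddTorus (Fin 3) → EuclideanSpace ℝ (Fin 3))
    (x : UnitAddTorus (Fin 3)) : ‖convect b tgForce x‖ ≤ 25 * ‖b x‖ := by
  have h1 := norm_convect_le_norm_mul_sqrt (isSmooth_tgForce.isContDiff (by simp)) b x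
  have hb : ∀ i, ‖partialDeriv i tgForce x‖ ^ 2 ≤ (12 : ℝ) ^ 2 := fun i =>
    pow_le_pow_left₀ (norm_nonneg _) (norm_partialDeriv_tgForce_le i x) 2
  have hsum : ∑ i, ‖partialDeriv i tgForce x‖ ^ 2 ≤ (25 : ℝ) ^ 2 := by
    calc ∑ i, ‖partialDeriv i tgForce x‖ ^ 2 ≤ ∑ _i : Fin 3, (12 : ℝ) ^ 2 :=
          Finset.sum_le_sum fun i _ => hb i
      _ ≤ (25 : ℝ) ^ 2 := by
          rw [Finset.sum_const, Finset.card_univ, Fintype.card_fin, nsmul_eq_mul]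
          norm_num
  have h2 : Real.sqrt (∑ i, ‖partialDeriv i tgForce x‖ ^ 2) ≤ 25 :=
    Real.sqrt_le_iff.2 ⟨by norm_num, hsum⟩
  calc ‖convect b tgForce x‖ ≤ ‖b x‖ * Real.sqrt (∑ i, ‖partialDeriv i tgForce x‖ ^ 2) := h1
    _ ≤ ‖b x‖ * 25 := mul_le_mul_of_nonneg_left h2 (norm_nonneg _)
    _ = 25 * ‖b x‖ := mul_comm _ _

/-! ## §2 The energy identity of a frozen-cell solution, tested with `b := v` -/

/-- **Step (1).**  If `v` is smooth, `v ⊥ f_TG`, and the frozen-cell tested equation of `U := 2•f_TG + v` holds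
against `b := v`, then `ν‖∇v‖² = ∫⟪U,(U·∇)v⟫` (`∫⟪f_TG, Δv⟫ = ∫⟪Δf_TG, v⟫ = −12π²∫⟪f_TG,v⟫ = 0`,
`∫⟪v, Δv⟫ = −‖∇v‖²`). [folklore] -/
theorem gradNormSq_eq_integral_inner_convect {ν : ℝ} {v : UnitAddTorus (Fin 3) → EuclideanSpace ℝ (Fin 3)}
    (hv : IsSmooth v) (horth : (∫ x, inner ℝ (tgForce x) (v x)) = 0)
    (htest : testedForm ν tgForce ((2 : ℝ) • tgForce + v) v = 0) :
    ν * gradNormSq v =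
      ∫ x, ⟪((2 : ℝ) • tgForce + v) x, convect ((2 : ℝ) • tgForce + v) v x⟫_ℝ := by
  have hUs : IsSmooth ((2 : ℝ) • tgForce + v) := (isSmooth_tgForce.smul 2).add hv
  have i1 : Integrable (fun x => ⟪((2 : ℝ) • tgForce + v) x, convect ((2 : ℝ) • tgForce + v) v x⟫_ℝ) volume :=
    (hUs.inner (hUs.convect hv)).integrable
  have i2 : Integrable (fun x => ν * ⟪((2 : ℝ) • tgForce + v) x, laplacian v x⟫_ℝ) volume :=
    (hUs.inner hv.laplacian).integrable.const_mul ν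
  have i3 : Integrable (fun x => ⟪tgForce x, v x⟫_ℝ) volume := (isSmooth_tgForce.inner hv).integrable
  have i12 : Integrable (fun x => ⟪((2 : ℝ) • tgForce + v) x, convect ((2 : ℝ) • tgForce + v) v x⟫_ℝ +
      ν * ⟪((2 : ℝ) • tgForce + v) x, laplacian v x⟫_ℝ) volume := i1.add i2
  have h := htest
  unfold testedForm at h
  rw [integral_add i12 i3, integral_add i1 i2, integral_const_mul, horth, add_zero] at h
  -- the viscous term
  have hvmem : MemLp v 2 volume :=
    hv.continuous.memLp_of_hasCompactSupport (HasCompactSupport.of_compactSpace _)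
  have hf : ∫ x, ⟪tgForce x, laplacian v x⟫_ℝ = 0 := by
    rw [← integral_inner_laplacian_comm isSmooth_tgForce hv]
    have hc : ∫ x, ⟪laplacian tgForce x, v x⟫_ℝ = ∫ x, ⟪v x, laplacian tgForce x⟫_ℝ :=
      integral_congr_ae (ae_of_all _ fun x => real_inner_comm _ _)
    rw [hc, Summit.AnomalousDissipation.AnomalousDissipation.Theorems.TaylorGreenLogLoudStates.Negative.integral_inner_laplacian_tgForce
      hvmem, horth, mul_zero]
  have hvv : ∫ x, ⟪v x, laplacian v x⟫_ℝ = -gradNormSq v := by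
    have hint : ∀ i, Integrable (fun x => ‖partialDeriv i v x‖ ^ 2) volume := fun i =>
      ((hv.partialDeriv i).continuous.norm.pow 2).integrable_unitAddTorus
    rw [integral_inner_laplacian_eq_neg_holds hv, gradNormSq, integral_finsetSum _ fun i _ => hint i]
  have hpt : ∀ x, ⟪((2 : ℝ) • tgForce + v) x, laplacian v x⟫_ℝ =
      2 * ⟪tgForce x, laplacian v x⟫_ℝ + ⟪v x, laplacian v x⟫_ℝ := by
    intro x
    simp only [Pi.add_apply, Pi.smul_apply, inner_add_left, real_inner_smul_left]
  have hlap : ∫ x, ⟪((2 : ℝ) • tgForce + v) x, laplacian v x⟫_ℝ = -gradNormSq v := by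
    simp_rw [hpt]
    rw [integral_add ((isSmooth_tgForce.inner hv.laplacian).integrable.const_mul 2)
      (hv.inner hv.laplacian).integrable, integral_const_mul, hf, hvv]
    ring
  rw [hlap] at h
  linarith

/-- **Step (2).**  For smooth divergence-free `v` (and the smooth divergence-free `f_TG`):
`∫⟪U,(U·∇)v⟫ = −4∫⟪(f·∇)f, v⟫ − 2∫⟪(v·∇)f, v⟫`, `U = 2•f + v` (`(U·∇)v = 2(f·∇)v + (v·∇)v` and the
antisymmetry `∫⟪(u·∇)a, w⟫ = −∫⟪a,(u·∇)w⟫`, which kills `∫⟪v,(f·∇)v⟫`, `∫⟪v,(v·∇)v⟫`). [folklore] -/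
theorem integral_inner_convect_gauge {v : UnitAddTorus (Fin 3) → EuclideanSpace ℝ (Fin 3)}
    (hv : IsSmooth v) (hdiv : IsDivFree v) :
    ∫ x, ⟪((2 : ℝ) • tgForce + v) x, convect ((2 : ℝ) • tgForce + v) v x⟫_ℝ =
      -4 * (∫ x, ⟪convect tgForce tgForce x, v x⟫_ℝ) - 2 * ∫ x, ⟪convect v tgForce x, v x⟫_ℝ := by
  have hs := isSmooth_tgForce
  have hpt : ∀ x, ⟪((2 : ℝ) • tgForce + v) x, convect ((2 : ℝ) • tgForce + v) v x⟫_ℝ =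
      4 * ⟪tgForce x, convect tgForce v x⟫_ℝ + 2 * ⟪tgForce x, convect v v x⟫_ℝ +
        (2 * ⟪v x, convect tgForce v x⟫_ℝ + ⟪v x, convect v v x⟫_ℝ) := by
    intro x
    simp only [convect, Pi.add_apply, Pi.smul_apply, map_add, map_smul, inner_add_left, inner_add_right,
      real_inner_smul_left, real_inner_smul_right]
    ring
  simp_rw [hpt]
  have ia : Integrable (fun x => ⟪tgForce x, convect tgForce v x⟫_ℝ) volume := (hs.inner (hs.convect hv)).integrable
  have ib : Integrable (fun x => ⟪tgForce x, convect v v x⟫_ℝ) volume := (hs.inner (hv.convect hv)).integrable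
  have ic : Integrable (fun x => ⟪v x, convect tgForce v x⟫_ℝ) volume := (hv.inner (hs.convect hv)).integrable
  have id' : Integrable (fun x => ⟪v x, convect v v x⟫_ℝ) volume := (hv.inner (hv.convect hv)).integrable
  have iab : Integrable (fun x => 4 * ⟪tgForce x, convect tgForce v x⟫_ℝ + 2 * ⟪tgForce x, convect v v x⟫_ℝ)
      volume := (ia.const_mul 4).add (ib.const_mul 2)
  have icd : Integrable (fun x => 2 * ⟪v x, convect tgForce v x⟫_ℝ + ⟪v x, convect v v x⟫_ℝ) volume :=
    (ic.const_mul 2).add id'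
  rw [integral_add iab icd, integral_add (ia.const_mul 4) (ib.const_mul 2), integral_add (ic.const_mul 2) id',
    integral_const_mul, integral_const_mul, integral_const_mul]
  have h1 : ∫ x, ⟪tgForce x, convect tgForce v x⟫_ℝ = -∫ x, ⟪convect tgForce tgForce x, v x⟫_ℝ := by
    have ha := integral_inner_convect_eq_neg hs isDivFree_tgForce hs hv
    linarith
  have h2 : ∫ x, ⟪tgForce x, convect v v x⟫_ℝ = -∫ x, ⟪convect v tgForce x, v x⟫_ℝ := by
    have ha := integral_inner_convect_eq_neg hv hdiv hs hv
    linarith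
  have h3 : ∫ x, ⟪v x, convect tgForce v x⟫_ℝ = 0 := by
    have ha := integral_inner_convect_eq_neg hs isDivFree_tgForce hv hv
    have hc : ∫ x, ⟪convect tgForce v x, v x⟫_ℝ = ∫ x, ⟪v x, convect tgForce v x⟫_ℝ :=
      integral_congr_ae (ae_of_all _ fun x => real_inner_comm _ _)
    linarith
  have h4 : ∫ x, ⟪v x, convect v v x⟫_ℝ = 0 := by
    have ha := integral_inner_convect_eq_neg hv hdiv hv hv
    have hc : ∫ x, ⟪convect v v x, v x⟫_ℝ = ∫ x, ⟪v x, convect v v x⟫_ℝ :=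
      integral_congr_ae (ae_of_all _ fun x => real_inner_comm _ _)
    linarith
  rw [h1, h2, h3, h4]
  ring

/-! ## §3 The two Cauchy–Schwarz bounds -/

/-- `|∫⟪(f_TG·∇)f_TG, v⟫| ≤ 25 √C` when `∫|v|² ≤ C` (`‖(f·∇)f‖ ≤ 25‖f‖ ≤ 25`, `∫‖v‖ ≤ √(∫‖v‖²)`). [folklore] -/
theorem abs_integral_inner_convect_tgForce_tgForce_le {C : ℝ} {v : UnitAddTorus (Fin 3) → EuclideanSpace ℝ (Fin 3)}
    (hv : IsSmooth v) (hen : ∫ x, ‖v x‖ ^ 2 ≤ C) :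
    |∫ x, ⟪convect tgForce tgForce x, v x⟫_ℝ| ≤ 25 * Real.sqrt C := by
  have hs := isSmooth_tgForce
  rw [← Real.norm_eq_abs]
  calc ‖∫ x, ⟪convect tgForce tgForce x, v x⟫_ℝ‖ ≤ ∫ x, ‖⟪convect tgForce tgForce x, v x⟫_ℝ‖ :=
        norm_integral_le_integral_norm _
    _ ≤ ∫ x, 25 * ‖v x‖ := by
        refine integral_mono ((hs.convect hs).inner hv).integrable.norm (hv.integrable.norm.const_mul 25)
          fun x => ?_
        calc ‖⟪convect tgForce tgForce x, v x⟫_ℝ‖ ≤ ‖convect tgForce tgForce x‖ * ‖v x‖ := norm_inner_le_norm _ _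
          _ ≤ 25 * ‖tgForce x‖ * ‖v x‖ :=
              mul_le_mul_of_nonneg_right (norm_convect_tgForce_le tgForce x) (norm_nonneg _)
          _ ≤ 25 * 1 * ‖v x‖ := by
              gcongr
              exact norm_tgForce_le x
          _ = 25 * ‖v x‖ := by ring
    _ = 25 * ∫ x, ‖v x‖ := integral_const_mul _ _
    _ ≤ 25 * Real.sqrt (∫ x, ‖v x‖ ^ 2) := by
        gcongr
        exact integral_norm_le_sqrt hv.continuous
    _ ≤ 25 * Real.sqrt C := by gcongr

/-- `|∫⟪(v·∇)f_TG, v⟫| ≤ 25 C` when `∫|v|² ≤ C` (`‖(v·∇)f‖ ≤ 25‖v‖`). [folklore] -/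
theorem abs_integral_inner_convect_self_tgForce_le {C : ℝ} {v : UnitAddTorus (Fin 3) → EuclideanSpace ℝ (Fin 3)}
    (hv : IsSmooth v) (hen : ∫ x, ‖v x‖ ^ 2 ≤ C) :
    |∫ x, ⟪convect v tgForce x, v x⟫_ℝ| ≤ 25 * C := by
  have hs := isSmooth_tgForce
  rw [← Real.norm_eq_abs]
  calc ‖∫ x, ⟪convect v tgForce x, v x⟫_ℝ‖ ≤ ∫ x, ‖⟪convect v tgForce x, v x⟫_ℝ‖ :=
        norm_integral_le_integral_norm _
    _ ≤ ∫ x, 25 * ‖v x‖ ^ 2 := by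
        refine integral_mono ((hv.convect hs).inner hv).integrable.norm
          ((hv.continuous.norm.pow 2).integrable_unitAddTorus.const_mul 25) fun x => ?_
        calc ‖⟪convect v tgForce x, v x⟫_ℝ‖ ≤ ‖convect v tgForce x‖ * ‖v x‖ := norm_inner_le_norm _ _
          _ ≤ 25 * ‖v x‖ * ‖v x‖ := mul_le_mul_of_nonneg_right (norm_convect_tgForce_le v x) (norm_nonneg _)
          _ = 25 * ‖v x‖ ^ 2 := by ring
    _ = 25 * ∫ x, ‖v x‖ ^ 2 := integral_const_mul _ _
    _ ≤ 25 * C := by gcongr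

/-! ## §4 The registered stub -/

/-- **stub_automaticLoudness** (loudness is automatic in the amplitude gauge; the registered signature of the line
`stagnation-plug-froth`, skeleton v4).  For a `K`-field `v ⊥ f_TG` whose gauge state `2•f_TG + v` solves the
frozen-cell tested equations at viscosity `ν > 0` against every `K`-field `b ⊥ f_TG`, and `∫|v|² ≤ C`:
`ν‖∇v‖² ≤ 100(√C + C)`.  Proof: test with `b := v` (`gradNormSq_eq_integral_inner_convect`), expand and use
antisymmetry (`integral_inner_convect_gauge`): `ν‖∇v‖² = −4∫⟪(f·∇)f, v⟫ − 2∫⟪(v·∇)f, v⟫ ≤ 100√C + 50C`.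
The `K`-symmetry and the zero mean of `v` are not used. [folklore] -/
theorem stub_automaticLoudness :
    ∀ (ν C : ℝ) (v : UnitAddTorus (Fin 3) → EuclideanSpace ℝ (Fin 3)), 0 < ν → 0 ≤ C → IsKField v →
      (∫ x, inner ℝ (tgForce x) (v x)) = 0 →
      (∀ b, IsKField b → (∫ x, inner ℝ (tgForce x) (b x)) = 0 →
        testedForm ν tgForce ((2 : ℝ) • tgForce + v) b = 0) →
      ∫ x, ‖v x‖ ^ 2 ≤ C → ν * gradNormSq v ≤ 100 * (Real.sqrt C + C) := by
  intro ν C v _hν hC hv horth htest hen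
  have h := htest v hv horth
  obtain ⟨hs, hdiv, -, -⟩ := hv
  have hid := gradNormSq_eq_integral_inner_convect hs horth h
  rw [integral_inner_convect_gauge hs hdiv] at hid
  have b1 := abs_le.1 (abs_integral_inner_convect_tgForce_tgForce_le hs hen)
  have b2 := abs_le.1 (abs_integral_inner_convect_self_tgForce_le hs hen)
  have hsC : 0 ≤ Real.sqrt C := Real.sqrt_nonneg C
  rw [hid]
  linarith [b1.1, b2.1]

end Summit.AnomalousDissipation.AnomalousDissipation.Theorems.TaylorGreenLoudGalerkinStates.AutomaticLoudness

end
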